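import Mathlib.NumberTheory.Divisors
import Mathlib.Data.Nat.ModEq
import Mathlib.Algebra.Order.BigOperators.Group.Finset
import Mathlib.Algebra.BigOperators.Ring.Finset
import Mathlib.Algebra.Group.Action.Defs
import Mathlib.Tactic.Ring
import Mathlib.Tactic.Linarith
import HarnessLib

/-!
# Counting products `mn` in residue windows (the counting behind Mauduit–Rivat 2015, Lemmas 7–9; proved)

Everything in this file is PROVED. In C. Mauduit, J. Rivat, *Prime numbers along Rudin–Shapiro
sequences*, J. Eur. Math. Soc. 17 (2015), §4, the carry-propagation lemmas (Lemma 7: "the number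
`N` of `(m, n)` … such that `mn = a + q^{μ'} b` with `b ∈ B` satisfies
`N ≤ (q^{μ'} log q + q^μ − q^{μ−1} + q^{μ'−μ+1}) card B`"; Lemma 9, whose printed proof detects the
middle digits `r_{μ₀,μ₂}(mn + am + bn + c) ∈ B` by the smoothed indicators of Lemma 1) reduce to
counting, for a fixed multiplier `m ≥ 1`, the `n` in an interval for which `(mn + c) mod Q` falls
into a union of short windows. We prove this count DIRECTLY (no exponential sums): along a block
of `Q / gcd(m, Q)` consecutive `n` the residues `(mn + c) mod Q` are distinct and congruent to `c`
modulo `d = gcd(m, Q)`, so each window `[a, a + L)` is hit at most `L/d + 2` times per block: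

* `card_window_le` —
  `#{n ∈ [N₀, N₀+N) : ∃ a ∈ starts, (mn+c) mod Q ∈ [a, a+L)} ≤ #starts · (N d/Q + 1) · (L/d + 2)`;
* `sum_Ico_gcd_le` — the `d`-average needed to sum over `m`: `∑_{M₀≤m<M₁} gcd(m, Q) ≤ 2 τ(Q) M₁`
  (`M₀ ≥ 1`), the source of the factors `τ(q^{·})` in Mauduit–Rivat's (22), (28).

## References
* C. Mauduit, J. Rivat, J. Eur. Math. Soc. 17 (2015), Lemmas 7 and 9 (pp. 2602–2605).
  [MauduitRivat2015]
-/

open Finset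

namespace Literature.NumberTheory.LFunctions.MauduitRivat

/-! ## Residues in a short window -/

/-- In a window `[a, a + L)` at most `L / d + 2` integers are `≡ c (mod d)` (`d ≥ 1`). [folklore] -/
theorem card_filter_mod_eq_le (a L c : ℕ) {d : ℕ} (hd : 0 < d) :
    ((Ico a (a + L)).filter (fun y => y % d = c)).card ≤ L / d + 2 := by
  have hinj : Set.InjOn (fun y => y / d) ↑((Ico a (a + L)).filter (fun y => y % d = c)) := by
    intro y hy y' hy' h
    simp only [coe_filter, Set.mem_setOf_eq] at hy hy'
    have e1 := Nat.div_add_mod y d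
    have e2 := Nat.div_add_mod y' d
    have h' : y / d = y' / d := h
    rw [h', hy.2] at e1
    rw [hy'.2] at e2
    omega
  calc ((Ico a (a + L)).filter (fun y => y % d = c)).card
      = (((Ico a (a + L)).filter (fun y => y % d = c)).image (fun y => y / d)).card :=
        (card_image_of_injOn hinj).symm
    _ ≤ (Icc (a / d) ((a + L) / d)).card := by
        refine card_le_card fun x hx => ?_
        simp only [mem_image, mem_filter, mem_Ico] at hx
        obtain ⟨y, ⟨⟨h1, h2⟩, -⟩, rfl⟩ := hx
        rw [mem_Icc]
        exact ⟨Nat.div_le_div_right h1, Nat.div_le_div_right h2.le⟩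
    _ = (a + L) / d + 1 - a / d := Nat.card_Icc _ _
    _ ≤ L / d + 2 := by
        have h1 : (a + L) / d ≤ a / d + L / d + 1 := by
          rw [Nat.add_div hd]
          split_ifs <;> omega
        generalize (a + L) / d = X at *
        generalize a / d = Y at *
        generalize L / d = Z at *
        omega

/-! ## Sums of gcd's -/

/-- `∑_{M₀ ≤ m < M₁} gcd(m, Q) ≤ 2 τ(Q) M₁` for `M₀ ≥ 1`. [cite: MauduitRivat2015, Lemma 5 (proof)] -/
theorem sum_Ico_gcd_le {M₀ M₁ Q : ℕ} (hM₀ : 1 ≤ M₀) (hQ : 0 < Q) :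
    ∑ m ∈ Ico M₀ M₁, Nat.gcd m Q ≤ 2 * Q.divisors.card * M₁ := by
  -- `gcd(m, Q)` is a divisor of `Q` dividing `m`
  have h1 : ∀ m ∈ Ico M₀ M₁, Nat.gcd m Q ≤
      ∑ d ∈ Q.divisors, if d ∣ m then d else 0 := by
    intro m _
    have hmem : Nat.gcd m Q ∈ Q.divisors := Nat.mem_divisors.2 ⟨Nat.gcd_dvd_right m Q, hQ.ne'⟩
    have := single_le_sum (f := fun d => if d ∣ m then d else 0) (fun d _ => Nat.zero_le _) hmem
    simp only [Nat.gcd_dvd_left, if_true] at this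
    exact this
  refine (sum_le_sum h1).trans ?_
  rw [sum_comm]
  -- for each divisor `d`: `∑_{m} [d ∣ m] d ≤ 2 M₁`
  have h2 : ∀ d ∈ Q.divisors, ∑ m ∈ Ico M₀ M₁, (if d ∣ m then d else 0) ≤ 2 * M₁ := by
    intro d hd
    have hd0 : 0 < d := Nat.pos_of_mem_divisors hd
    rw [← sum_filter]
    rw [sum_const, smul_eq_mul]
    -- the multiples of `d` in `[M₀, M₁)` inject into `[1, M₁/d]` via `m ↦ m/d`... we bound crudely:
    by_cases hdM : M₁ ≤ d
    · -- no multiple of `d` lies in `[1, M₁)` when `d ≥ M₁`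
      have : ((Ico M₀ M₁).filter (fun m => d ∣ m)) = ∅ := by
        refine filter_eq_empty_iff.2 fun m hm hdm => ?_
        rw [mem_Ico] at hm
        have := Nat.le_of_dvd (by omega) hdm
        omega
      rw [this, card_empty, zero_mul]
      exact Nat.zero_le _
    · have hdM : d < M₁ := lt_of_not_ge hdM
      have hcard : ((Ico M₀ M₁).filter (fun m => d ∣ m)).card ≤ M₁ / d + 1 := by
        have hinj : Set.InjOn (fun m => m / d) ↑((Ico M₀ M₁).filter (fun m => d ∣ m)) := by
          intro y hy y' hy' h
          simp only [coe_filter, Set.mem_setOf_eq] at hy hy'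
          have e1 := Nat.div_mul_cancel hy.2
          have e2 := Nat.div_mul_cancel hy'.2
          have : y / d = y' / d := h
          calc y = y / d * d := e1.symm
            _ = y' / d * d := by rw [this]
            _ = y' := e2
        calc ((Ico M₀ M₁).filter (fun m => d ∣ m)).card
            = (((Ico M₀ M₁).filter (fun m => d ∣ m)).image (fun m => m / d)).card :=
              (card_image_of_injOn hinj).symm
          _ ≤ (range (M₁ / d + 1)).card := by
              refine card_le_card fun x hx => ?_
              simp only [mem_image, mem_filter, mem_Ico] at hx
              obtain ⟨y, ⟨⟨-, h2⟩, -⟩, rfl⟩ := hx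
              rw [mem_range]
              exact Nat.lt_succ_of_le (Nat.div_le_div_right h2.le)
          _ = M₁ / d + 1 := card_range _
      calc ((Ico M₀ M₁).filter (fun m => d ∣ m)).card * d ≤ (M₁ / d + 1) * d :=
            Nat.mul_le_mul_right _ hcard
        _ = M₁ / d * d + d := by ring
        _ ≤ M₁ + M₁ := add_le_add (Nat.div_mul_le_self _ _) hdM.le
        _ = 2 * M₁ := by ring
  calc ∑ d ∈ Q.divisors, ∑ m ∈ Ico M₀ M₁, (if d ∣ m then d else 0)
      ≤ ∑ _d ∈ Q.divisors, 2 * M₁ := sum_le_sum h2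
    _ = 2 * Q.divisors.card * M₁ := by rw [sum_const, smul_eq_mul]; ring

/-! ## The window count -/

/-- Along `P = Q / gcd(m, Q)` consecutive integers `n`, the residues `(mn + c) mod Q` are distinct.
[folklore] -/
theorem injOn_mul_add_mod {m Q : ℕ} (hQ : 0 < Q) (c n₀ : ℕ) :
    Set.InjOn (fun n => (m * n + c) % Q) ↑(Ico n₀ (n₀ + Q / Nat.gcd m Q)) := by
  intro n hn n' hn' h
  simp only [coe_Ico, Set.mem_Ico] at hn hn'
  have hmod : m * n + c ≡ m * n' + c [MOD Q] := h
  have h1 : m * n ≡ m * n' [MOD Q] := Nat.ModEq.add_right_cancel' c hmod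
  have h2 : n ≡ n' [MOD Q / Nat.gcd Q m] := Nat.ModEq.cancel_left_div_gcd hQ h1
  rw [Nat.gcd_comm] at h2
  -- both lie in a window of length `Q / gcd`
  set P := Q / Nat.gcd m Q with hP
  rcases le_total n n' with hle | hle
  · have hd : P ∣ n' - n := (Nat.modEq_iff_dvd' hle).1 h2
    have hlt : n' - n < P := by omega
    have := Nat.eq_zero_of_dvd_of_lt hd hlt
    omega
  · have hd : P ∣ n - n' := (Nat.modEq_iff_dvd' hle).1 h2.symm
    have hlt : n - n' < P := by omega
    have := Nat.eq_zero_of_dvd_of_lt hd hlt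
    omega

/-- One block: among `P = Q/gcd(m,Q)` consecutive `n`, at most `L/gcd(m,Q) + 2` have
`(mn + c) mod Q ∈ [a, a + L)`. [cite: MauduitRivat2015, Lemma 7 (proof)] -/
theorem card_block_window_le {m Q : ℕ} (hQ : 0 < Q) (c n₀ a L : ℕ) :
    ((Ico n₀ (n₀ + Q / Nat.gcd m Q)).filter
        (fun n => a ≤ (m * n + c) % Q ∧ (m * n + c) % Q < a + L)).card ≤ L / Nat.gcd m Q + 2 := by
  set d := Nat.gcd m Q with hd
  have hd0 : 0 < d := Nat.gcd_pos_of_pos_right _ hQ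
  have hdQ : d ∣ Q := Nat.gcd_dvd_right m Q
  have hdm : d ∣ m := Nat.gcd_dvd_left m Q
  -- inject into the residues `≡ c mod d` of the window
  have hmaps : ∀ n ∈ (Ico n₀ (n₀ + Q / d)).filter
      (fun n => a ≤ (m * n + c) % Q ∧ (m * n + c) % Q < a + L),
      (m * n + c) % Q ∈ (Ico a (a + L)).filter (fun y => y % d = c % d) := by
    intro n hn
    rw [mem_filter] at hn
    rw [mem_filter, mem_Ico]
    refine ⟨hn.2, ?_⟩
    have hmn : m * n % d = 0 := Nat.mod_eq_zero_of_dvd (dvd_mul_of_dvd_left hdm n)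
    rw [Nat.mod_mod_of_dvd _ hdQ, Nat.add_mod, hmn, zero_add, Nat.mod_mod]
  have hinj : Set.InjOn (fun n => (m * n + c) % Q) ↑((Ico n₀ (n₀ + Q / d)).filter
      (fun n => a ≤ (m * n + c) % Q ∧ (m * n + c) % Q < a + L)) :=
    (injOn_mul_add_mod hQ c n₀).mono (by
      intro n hn; simp only [coe_filter, Set.mem_setOf_eq] at hn; exact hn.1)
  calc ((Ico n₀ (n₀ + Q / d)).filter
        (fun n => a ≤ (m * n + c) % Q ∧ (m * n + c) % Q < a + L)).card
      ≤ ((Ico a (a + L)).filter (fun y => y % d = c % d)).card :=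
        card_le_card_of_injOn _ hmaps hinj
    _ ≤ L / d + 2 := card_filter_mod_eq_le a L (c % d) hd0

/-- **The window count** (the counting in Mauduit–Rivat's Lemmas 7 and 9, direct form): for
`m`, `Q ≥ 1`, `c`, an interval `[N₀, N₀ + N)` of `n`, and a finite set of windows `[a, a + L)`
(`a ∈ starts`),
`#{n ∈ [N₀, N₀+N) : ∃ a ∈ starts, (mn + c) mod Q ∈ [a, a + L)} ≤ #starts · (N gcd(m,Q)/Q + 1) · (L/gcd(m,Q) + 2)`.
[cite: MauduitRivat2015, Lemma 7 and Lemma 9 (proofs)] -/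
theorem card_window_le {m Q : ℕ} (hQ : 0 < Q) (c N₀ N L : ℕ) (starts : Finset ℕ) :
    ((Ico N₀ (N₀ + N)).filter (fun n => ∃ a ∈ starts,
        a ≤ (m * n + c) % Q ∧ (m * n + c) % Q < a + L)).card ≤
      starts.card * (N * Nat.gcd m Q / Q + 1) * (L / Nat.gcd m Q + 2) := by
  set d := Nat.gcd m Q with hd
  have hd0 : 0 < d := Nat.gcd_pos_of_pos_right _ hQ
  have hdQ : d ∣ Q := Nat.gcd_dvd_right m Q
  set P := Q / d with hP
  have hP0 : 0 < P := Nat.div_pos (Nat.le_of_dvd hQ hdQ) hd0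
  have hPQ : P * d = Q := Nat.div_mul_cancel hdQ
  -- the number of blocks
  have hblocks : N * d / Q = N / P := by
    rw [← hPQ, Nat.mul_div_mul_right _ _ hd0]
  rw [hblocks]
  -- cover `[N₀, N₀ + N)` by the blocks `[N₀ + jP, N₀ + jP + P)`, `j ≤ N / P`
  have hcover : Ico N₀ (N₀ + N) ⊆
      (range (N / P + 1)).biUnion (fun j => Ico (N₀ + j * P) (N₀ + j * P + P)) := by
    intro n hn
    rw [mem_Ico] at hn
    rw [mem_biUnion]
    refine ⟨(n - N₀) / P, mem_range.2 (Nat.lt_succ_of_le (Nat.div_le_div_right (by omega))), ?_⟩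
    rw [mem_Ico]
    have h1 := Nat.div_add_mod (n - N₀) P
    have h2 := Nat.mod_lt (n - N₀) hP0
    constructor
    · have : (n - N₀) / P * P ≤ n - N₀ := Nat.div_mul_le_self _ _
      omega
    · have : n - N₀ < (n - N₀) / P * P + P := by
        rw [mul_comm] ; omega
      omega
  calc ((Ico N₀ (N₀ + N)).filter (fun n => ∃ a ∈ starts,
          a ≤ (m * n + c) % Q ∧ (m * n + c) % Q < a + L)).card
      ≤ (((range (N / P + 1)).biUnion (fun j => Ico (N₀ + j * P) (N₀ + j * P + P))).filter
          (fun n => ∃ a ∈ starts, a ≤ (m * n + c) % Q ∧ (m * n + c) % Q < a + L)).card :=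
        card_le_card (filter_subset_filter _ hcover)
    _ ≤ ∑ j ∈ range (N / P + 1), ((Ico (N₀ + j * P) (N₀ + j * P + P)).filter
          (fun n => ∃ a ∈ starts, a ≤ (m * n + c) % Q ∧ (m * n + c) % Q < a + L)).card := by
        rw [filter_biUnion]
        exact card_biUnion_le
    _ ≤ ∑ _j ∈ range (N / P + 1), starts.card * (L / d + 2) := by
        refine sum_le_sum fun j _ => ?_
        -- split over the windows
        calc ((Ico (N₀ + j * P) (N₀ + j * P + P)).filter
              (fun n => ∃ a ∈ starts, a ≤ (m * n + c) % Q ∧ (m * n + c) % Q < a + L)).card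
            ≤ (starts.biUnion fun a => (Ico (N₀ + j * P) (N₀ + j * P + P)).filter
                (fun n => a ≤ (m * n + c) % Q ∧ (m * n + c) % Q < a + L)).card := by
              refine card_le_card fun n hn => ?_
              rw [mem_filter] at hn
              obtain ⟨hn, a, ha, h⟩ := hn
              exact mem_biUnion.2 ⟨a, ha, mem_filter.2 ⟨hn, h⟩⟩
          _ ≤ ∑ a ∈ starts, ((Ico (N₀ + j * P) (N₀ + j * P + P)).filter
                (fun n => a ≤ (m * n + c) % Q ∧ (m * n + c) % Q < a + L)).card := card_biUnion_le
          _ ≤ ∑ _a ∈ starts, (L / d + 2) :=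
              sum_le_sum fun a _ => card_block_window_le hQ c _ a L
          _ = starts.card * (L / d + 2) := by rw [sum_const, smul_eq_mul]
    _ = starts.card * (N / P + 1) * (L / d + 2) := by
        rw [sum_const, card_range, smul_eq_mul]; ring

end Literature.NumberTheory.LFunctions.MauduitRivat
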